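import Summits.CriticalPhenomena.PercolationContinuityZ3.Theses.PercQuarantineIslands
import HarnessLib

/-!
# Skeleton line `height-squeeze` for the crux `FatMassKillsJump` (stmt-CriticalPhenomena-18142; child of the split of
# `FiniteClusterVolumeTail`, route PercQuarantineIslands, 2026-08-17)

`FatMassKillsJump := PercBoundarySqueeze.FreeBoxFatClusterMass → PercolationContinuityZ3` ("the critical fat free-box mass bound kills the
jump"). Two registered stubs and the kernel-checked composition `FatMassKillsJump_of`:

* `stub_heightArmFourFifths` — OPEN: this route's H (stmt-CriticalPhenomena-7071) VERBATIM, a height one-arm exponent `4/5 + κ` at `p_c(ℤ³)`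
  (its own skeleton: `Cruxes/HalfSpaceOneArmFourFifths/Lines/birth.lean`). Load-bearing.
* `stub_heightSqueeze` — PROVABLE NOW, in fact PROVED: `H → FreeBoxFatClusterMass → PercolationContinuityZ3`, the height squeeze
  (`Cruxes/FiniteClusterVolumeTail/HeightSqueezeSplit.lean`, theorem `heightSqueeze`, sorry-free, axioms standard; a stub-worker lands it with
  `propose --supports stmt-CriticalPhenomena-18142` proving this stub verbatim). Sorried here only so that the skeleton is self-contained.

Line card: `Lines/height-squeeze.md`.
-/

namespace Summit.CriticalPhenomena.PercolationContinuityZ3.Cruxes.FatMassKillsJump.HeightSqueezeLine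

/-- Statement of stub 1 = H (stmt-7071) verbatim. -/
abbrev HeightArmFourFifthsStmt : Prop :=
  ∃ κ C : ℝ, 0 < κ ∧ ∀ h : ℕ, 1 ≤ h → (Literature.Probability.Percolation.bondPercolation (Literature.Probability.LatticeModels.zdGraph 3) (Literature.Probability.Percolation.criticalProbI 3)).real {ω | ∃ y : Literature.Probability.LatticeModels.Site 3, y 0 = (h : ℤ) ∧ ω ∈ Literature.Probability.Percolation.openConnIn {x : Literature.Probability.LatticeModels.Site 3 | 0 ≤ x 0} 0 y} ≤ C * (h : ℝ) ^ (-(4 / 5 + κ))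

/-- Statement of stub 2 = the height squeeze. -/
abbrev HeightSqueezeStmt : Prop :=
  (∃ κ C : ℝ, 0 < κ ∧ ∀ h : ℕ, 1 ≤ h → (Literature.Probability.Percolation.bondPercolation (Literature.Probability.LatticeModels.zdGraph 3) (Literature.Probability.Percolation.criticalProbI 3)).real {ω | ∃ y : Literature.Probability.LatticeModels.Site 3, y 0 = (h : ℤ) ∧ ω ∈ Literature.Probability.Percolation.openConnIn {x : Literature.Probability.LatticeModels.Site 3 | 0 ≤ x 0} 0 y} ≤ C * (h : ℝ) ^ (-(4 / 5 + κ))) → Summit.CriticalPhenomena.PercolationContinuityZ3.Theses.PercBoundarySqueeze.FreeBoxFatClusterMass → _root_.PercolationContinuityZ3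

/-- **stub_heightArmFourFifths (OPEN; load-bearing)** — H verbatim. [folklore] -/
theorem stub_heightArmFourFifths : ∃ κ C : ℝ, 0 < κ ∧ ∀ h : ℕ, 1 ≤ h → (Literature.Probability.Percolation.bondPercolation (Literature.Probability.LatticeModels.zdGraph 3) (Literature.Probability.Percolation.criticalProbI 3)).real {ω | ∃ y : Literature.Probability.LatticeModels.Site 3, y 0 = (h : ℤ) ∧ ω ∈ Literature.Probability.Percolation.openConnIn {x : Literature.Probability.LatticeModels.Site 3 | 0 ≤ x 0} 0 y} ≤ C * (h : ℝ) ^ (-(4 / 5 + κ)) := by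
  sorry

/-- **stub_heightSqueeze (PROVED elsewhere: `Cruxes/FiniteClusterVolumeTail/HeightSqueezeSplit.lean`, `heightSqueeze`)** — the height squeeze.
[folklore] -/
theorem stub_heightSqueeze : (∃ κ C : ℝ, 0 < κ ∧ ∀ h : ℕ, 1 ≤ h → (Literature.Probability.Percolation.bondPercolation (Literature.Probability.LatticeModels.zdGraph 3) (Literature.Probability.Percolation.criticalProbI 3)).real {ω | ∃ y : Literature.Probability.LatticeModels.Site 3, y 0 = (h : ℤ) ∧ ω ∈ Literature.Probability.Percolation.openConnIn {x : Literature.Probability.LatticeModels.Site 3 | 0 ≤ x 0} 0 y} ≤ C * (h : ℝ) ^ (-(4 / 5 + κ))) → Summit.CriticalPhenomena.PercolationContinuityZ3.Theses.PercBoundarySqueeze.FreeBoxFatClusterMass → _root_.PercolationContinuityZ3 := by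
  sorry

/-! ### Name-keyed aliases of the stub statements (device of the sibling birth skeletons: the native skeleton audit
admits hypotheses iff they are registered stubs BY NAME) -/
namespace __Registered
/-- Alias of `HeightArmFourFifthsStmt` keyed by the registered stub name. -/
abbrev stub_heightArmFourFifths : Prop := HeightArmFourFifthsStmt
/-- Alias of `HeightSqueezeStmt` keyed by the registered stub name. -/
abbrev stub_heightSqueeze : Prop := HeightSqueezeStmt
end __Registered

/-- **Composition (kernel-checked, no `sorry` of its own)**: the two stubs give the crux BY NAME. -/
theorem FatMassKillsJump_of (h₁ : __Registered.stub_heightArmFourFifths) (h₂ : __Registered.stub_heightSqueeze) :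
    Summit.CriticalPhenomena.PercolationContinuityZ3.Theses.PercQuarantineIslands.FatMassKillsJump :=
  fun hF => h₂ h₁ hF

/-- Wiring check: the registered stubs feed the composition. -/
example : Summit.CriticalPhenomena.PercolationContinuityZ3.Theses.PercQuarantineIslands.FatMassKillsJump :=
  FatMassKillsJump_of stub_heightArmFourFifths stub_heightSqueeze

end Summit.CriticalPhenomena.PercolationContinuityZ3.Cruxes.FatMassKillsJump.HeightSqueezeLine
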